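import Literature.Computability.Cryptography.ChenQuantumLWEDatumOptimum

/-!
# The datum value of Chen's Step-9 register in closed form: `gcd` and divisor sums (T13/T14 supplement)

REPRODUCTION / ANALYSIS OF A CLAIMED RESULT UNDER ADJUDICATION (withdrawn): Yilei Chen, *Quantum
Algorithms for Lattice Problems*, IACR ePrint 2024/555, version of 2024-04-18 [ChenQuantumLattice2024]
(the version carrying the author's note that Step 9 contains a bug), Step 9 (§3.5.9, pp. 34–38).  Bundle
`papers/QuantumAdvantage/lwe-quantum-autopsy/`, Part 2 (`REPAIR-CENSUS.md` §1 theorems **T13/T14**, §21),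
on top of `ChenQuantumLWEDatumOptimum.lean` (T13: `datumValue`, `datumValue_eq_sum_pow`,
`card_span_mul_card_ann`).
HONEST FRAMING: kernel-checked elementary number theory making an already formalised EXACT VALUE (the
optimum `V(Q, m)` of the datum read-out of a register of a WITHDRAWN algorithm, T13 single run / T14 all
runs jointly) computable by hand — a decidable verdict completing a precise NEGATIVE result; NOT summit
progress, no cryptanalytic claim in either direction, no new algorithm for any lattice problem.

## What is proved

T13 left `V(Q, m) = Q^{-(m+1)}·Σ_{σ ∈ ℤ_Q} #{x ∈ ℤ_Q : σx = 0}^m` (`datumValue_eq_sum_pow`) and delegated the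
identification of the summand to "the reader and the bundle numerics".  Here:
* `card_mulKer_eq_gcd`: `#{x ∈ ℤ_Q : σx = 0} = gcd(Q, σ)` (from T13's duality `#span·#ann = Q` for a
  single generator and `#⟨σ⟩ = Q/gcd(Q, σ)`, Mathlib's `ZMod.addOrderOf_coe`);
* `datumValue_eq_sum_gcd_pow`: `V(Q, m) = Q^{-(m+1)}·Σ_{σ ∈ ℤ_Q} gcd(Q, σ)^m`;
* `sum_gcd_eq_sum_divisors`, `datumValue_eq_sum_divisors`: `V(Q, m) = Q^{-(m+1)}·Σ_{d ∣ Q} φ(Q/d)·d^m`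
  (Mathlib's `Nat.totient_div_of_dvd`: `#{k < Q : gcd(Q,k) = d} = φ(Q/d)`);
* worked instances by `decide` + `norm_num`: `V(15, 1) = 1/5`, `V(21, 1) = 65/441`, `V(105, 1) = 13/245`
  (`datumValue_fifteen_one`, `datumValue_twentyone_one`, `datumValue_onehundredfive_one`) — the numbers
  quoted in the census (§17, §20, §21) are now kernel facts, against T11's coarse several-runs bound
  `0.502`, `0.456`, `0.547` which T14 shows is never the truth for composite `Q`.

References: [ChenQuantumLattice2024] as above; [Korobov1992] Ch. I §1 (orthogonality of characters, via
T13's duality).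
-/

namespace Literature.Computability.Cryptography.Chen2024

open scoped BigOperators

section GcdForm

variable (Q : ℕ+)

/-- The span of a single residue is the subgroup of its multiples. [folklore] -/
theorem span_single_eq_zmultiples (σ : ZQ Q) :
    span Q (fun _ : Unit => σ) = AddSubgroup.zmultiples σ := by
  ext x
  rw [mem_span_iff, AddSubgroup.mem_zmultiples_iff]
  simp only [Fintype.sum_unique]
  constructor
  · rintro ⟨c, rfl⟩
    refine ⟨((c default).val : ℤ), ?_⟩
    rw [zsmul_eq_mul, Int.cast_natCast, ZMod.natCast_zmod_val]
  · rintro ⟨k, rfl⟩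
    exact ⟨fun _ => (k : ZQ Q), by rw [zsmul_eq_mul]⟩

/-- `#span(σ) = #⟨σ⟩ = Q / gcd(Q, σ)`. [folklore] -/
theorem card_span_single (σ : ZQ Q) :
    Nat.card (span Q (fun _ : Unit => σ)) = ((Q : ℕ+) : ℕ) / Nat.gcd Q σ.val := by
  have h := ZMod.addOrderOf_coe σ.val (PNat.ne_zero Q)
  rw [ZMod.natCast_zmod_val] at h
  rw [span_single_eq_zmultiples, Nat.card_zmultiples, h]

/-- **The multiplication kernel counts the gcd**: `#{x ∈ ℤ_Q : σ·x = 0} = gcd(Q, σ)` — T13's duality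
`#span(σ)·#ann(σ) = Q` with `#span(σ) = Q/gcd(Q, σ)`. [folklore] -/
theorem card_mulKer_eq_gcd (σ : ZQ Q) : Nat.card {x : ZQ Q // σ * x = 0} = Nat.gcd Q σ.val := by
  have h := card_span_mul_card_ann Q (fun _ : Unit => σ)
  have he : Nat.card {τ : ZQ Q // ∀ _i : Unit, τ * σ = 0} = Nat.card {x : ZQ Q // σ * x = 0} :=
    Nat.card_congr (Equiv.subtypeEquivRight fun τ =>
      ⟨fun hτ => by rw [mul_comm]; exact hτ (), fun hτ _ => by rw [mul_comm]; exact hτ⟩)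
  rw [he, card_span_single] at h
  have hg : Nat.gcd Q σ.val ∣ ((Q : ℕ+) : ℕ) := Nat.gcd_dvd_left _ _
  have hgpos : 0 < Nat.gcd Q σ.val := Nat.gcd_pos_of_pos_left _ (PNat.pos Q)
  have hQg : ((Q : ℕ+) : ℕ) / Nat.gcd Q σ.val * Nat.gcd Q σ.val = Q := Nat.div_mul_cancel hg
  have hpos : 0 < ((Q : ℕ+) : ℕ) / Nat.gcd Q σ.val := Nat.div_pos (Nat.le_of_dvd (PNat.pos Q) hg) hgpos
  exact Nat.eq_of_mul_eq_mul_left hpos (h.trans hQg.symm)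

variable {ι : Type*} [Fintype ι] [DecidableEq ι]

variable (ι) in
/-- **The value as a gcd moment**: `V(Q, ι) = Q^{-(#ι+1)}·Σ_{σ ∈ ℤ_Q} gcd(Q, σ)^{#ι}`.
[cite: ChenQuantumLattice2024, §3.5.9 pp. 35–37] -/
theorem datumValue_eq_sum_gcd_pow :
    datumValue Q ι = (∑ σ : ZQ Q, ((Nat.gcd Q σ.val : ℕ) : ℝ) ^ Fintype.card ι)
      / (((Q : ℕ+) : ℕ) : ℝ) ^ (Fintype.card ι + 1) := by
  rw [datumValue_eq_sum_pow]
  simp_rw [card_mulKer_eq_gcd]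

/-- Reindexing a sum over `ℤ_N` by the representatives `0 ≤ k < N`. [folklore] -/
theorem sum_zmod_val_eq_sum_range {N : ℕ} [NeZero N] (g : ℕ → ℝ) :
    ∑ σ : ZMod N, g σ.val = ∑ k ∈ Finset.range N, g k := by
  refine Finset.sum_nbij ZMod.val (fun σ _ => Finset.mem_range.2 (ZMod.val_lt σ))
    (ZMod.val_injective N).injOn ?_ (fun _ _ => rfl)
  intro k hk
  exact ⟨(k : ZMod N), Finset.mem_coe.2 (Finset.mem_univ _), ZMod.val_cast_of_lt (Finset.mem_range.1 hk)⟩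

/-- **Summing a function of `gcd(Q, σ)` over `ℤ_Q`**: `Σ_σ f(gcd(Q, σ)) = Σ_{d ∣ Q} φ(Q/d)·f(d)`
(`#{k < Q : gcd(Q, k) = d} = φ(Q/d)`). [folklore] -/
theorem sum_gcd_eq_sum_divisors (f : ℕ → ℝ) :
    ∑ σ : ZQ Q, f (Nat.gcd Q σ.val)
      = ∑ d ∈ ((Q : ℕ+) : ℕ).divisors, (Nat.totient (((Q : ℕ+) : ℕ) / d) : ℝ) * f d := by
  rw [sum_zmod_val_eq_sum_range (fun k => f (Nat.gcd Q k)),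
    ← Finset.sum_fiberwise_of_maps_to (s := Finset.range ((Q : ℕ+) : ℕ)) (t := ((Q : ℕ+) : ℕ).divisors)
      (g := fun k => Nat.gcd Q k)
      (fun k _ => Nat.mem_divisors.2 ⟨Nat.gcd_dvd_left _ _, PNat.ne_zero Q⟩)]
  refine Finset.sum_congr rfl fun d hd => ?_
  rw [Nat.totient_div_of_dvd (Nat.dvd_of_mem_divisors hd),
    Finset.sum_congr rfl fun k hk => by rw [(Finset.mem_filter.1 hk).2], Finset.sum_const, nsmul_eq_mul]

variable (ι) in
/-- **The value as a divisor sum**: `V(Q, ι) = Q^{-(#ι+1)}·Σ_{d ∣ Q} φ(Q/d)·d^{#ι}` (for prime `Q`: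
`((Q−1) + Q^{#ι})/Q^{#ι+1} = 1/Q + (1 − 1/Q)/Q^{#ι}`, T12's value). [cite: ChenQuantumLattice2024, §3.5.9 pp. 35–37] -/
theorem datumValue_eq_sum_divisors :
    datumValue Q ι = (∑ d ∈ ((Q : ℕ+) : ℕ).divisors,
        (Nat.totient (((Q : ℕ+) : ℕ) / d) : ℝ) * ((d : ℕ) : ℝ) ^ Fintype.card ι)
      / (((Q : ℕ+) : ℕ) : ℝ) ^ (Fintype.card ι + 1) := by
  rw [datumValue_eq_sum_gcd_pow, sum_gcd_eq_sum_divisors Q (fun d : ℕ => ((d : ℕ) : ℝ) ^ Fintype.card ι)]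

/-! ### Worked instances (the numbers quoted in the census) -/

/-- `V(15, 1) = (8·1 + 4·3 + 2·5 + 1·15)/15² = 45/225 = 1/5` (T11's coarse several-runs bound: `0.502`).
[folklore] -/
theorem datumValue_fifteen_one (hι : Fintype.card ι = 1) : datumValue 15 ι = 1 / 5 := by
  have hnat : ∑ d ∈ (15 : ℕ).divisors, Nat.totient (15 / d) * d ^ 1 = 45 := by decide
  have hcast : ∑ d ∈ (15 : ℕ).divisors, (Nat.totient (15 / d) : ℝ) * ((d : ℕ) : ℝ) ^ 1 = 45 := by
    exact_mod_cast hnat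
  have h15 : ((15 : ℕ+) : ℕ) = 15 := rfl
  rw [datumValue_eq_sum_divisors, hι, h15, hcast]
  norm_num

/-- `V(21, 1) = (12·1 + 6·3 + 2·7 + 1·21)/21² = 65/441` (T11's coarse bound: `0.456`). [folklore] -/
theorem datumValue_twentyone_one (hι : Fintype.card ι = 1) : datumValue 21 ι = 65 / 441 := by
  have hnat : ∑ d ∈ (21 : ℕ).divisors, Nat.totient (21 / d) * d ^ 1 = 65 := by decide
  have hcast : ∑ d ∈ (21 : ℕ).divisors, (Nat.totient (21 / d) : ℝ) * ((d : ℕ) : ℝ) ^ 1 = 65 := by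
    exact_mod_cast hnat
  have h21 : ((21 : ℕ+) : ℕ) = 21 := rfl
  rw [datumValue_eq_sum_divisors, hι, h21, hcast]
  norm_num

/-- `V(105, 1) = 585/105² = 13/245 ≈ 0.0531` — a modulus of Chen's shape `Q = 3·5·7` (T11's coarse
several-runs bound: `0.547`, a factor `10.3` above the truth). [folklore] -/
theorem datumValue_onehundredfive_one (hι : Fintype.card ι = 1) : datumValue 105 ι = 13 / 245 := by
  have hnat : ∑ d ∈ (105 : ℕ).divisors, Nat.totient (105 / d) * d ^ 1 = 585 := by decide
  have hcast : ∑ d ∈ (105 : ℕ).divisors, (Nat.totient (105 / d) : ℝ) * ((d : ℕ) : ℝ) ^ 1 = 585 := by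
    exact_mod_cast hnat
  have h105 : ((105 : ℕ+) : ℕ) = 105 := rfl
  rw [datumValue_eq_sum_divisors, hι, h105, hcast]
  norm_num

end GcdForm

end Literature.Computability.Cryptography.Chen2024
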